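import Literature.MathematicalPhysics.QuantumFieldTheory.ConformalBootstrap3D.PointKernelK34L515.Cert

/-!
# K34L515 instance, cell `l6c3` (parts file: groups 0:32)

Kernel-v3 cell of the point-functional exclusion instance for the lower box `Δσ ∈ [0.515, 0.520]`,
`Δε ∈ [0.6, 0.95)` (certificate `certL515`, module `PointKernelK34L515.Cert`): spin `ℓ = 6`,
`Δ ∈ [59/8, 119/16)` (centre `A`, half-width `2^-5`), Taylor degree `4`, `n_F = 50`, `1` s-piece(s)
covering `s = Δσ ∈ [103/200, 13/25]`.  Group theorems `l6c3_part<i>_<a>_<b> : gPart … = some <literal>` are checked by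
`decide +kernel` (the literals were produced by `#eval` of the same function); the cell numbers `l6c3_num<i> ≥ 0`
likewise; `l6c3_block` is `PKTM.blockPositive_of_cellPass` applied to them. This file holds only group theorems (the cell stated as a literal); the final file of the cell imports it.  Generated by
`gen/mk_v3cell.py` / `gen/drive_v3.py` (typer-g8).  [folklore]
-/

set_option Elab.async false

namespace Literature.MathematicalPhysics.QuantumFieldTheory.ConformalBootstrap3D

namespace PointKernelK34L515

open PointKernel PKTM
open Literature.Analysis.ValidatedNumerics.PolyMP
open Literature.Analysis.ValidatedNumerics.NumericsMP

/-- group model literal [folklore] -/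
def l6c3_g0_32_34 : G3 := ([⟨552896805883399855261819570395999873310, 552896805969691495312302032317198593275⟩, ⟨58483648239768998348698155495539819164, 58483648376521659082484034779334656934⟩, ⟨-1521033518293611520505373844632165647, -1521033330755108532869303351097018983⟩, ⟨2756938995171725493925925481712907854, 2756939193110447997037034989232953550⟩, ⟨-1844398632271457845463034621236528572, -1844398456704245360128727952218016479⟩], [⟨-6665017257115110578804444208937455147, -6665017256078566711758361944243224710⟩, ⟨-699303045421588830927472112753630335, -699303043774163863987792888811534568⟩, ⟨15358983170760278775246041418814731, 15358985430289723605036194541048390⟩, ⟨-32266288252622836997355158726569151, -32266285867445657443696926401200918⟩, ⟨21977374090506117095156662983097541, 21977376206425535366108476117440582⟩], [⟨40634162167133609031697420083268853, 40634162173445550246726271545291818⟩, ⟨4254797205809408052933548930101278, 4254797215853447363773495717763097⟩, ⟨-86669076697581436683356869727809, -86669062919440820201192477681644⟩, ⟨194776696953936068468384320556342, 194776711500917334518855519072841⟩, ⟨-133444937561072787666565161922386, -133444924653707253169474600363060⟩])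

/-- group `[32, 34)` of piece 0 [folklore] -/
theorem l6c3_part0_32_34 : gPart certL515 (⟨6, ((237 : ℚ) / 32), 5, 4, 50, 6, 64, ⟨3, 0, 5, 90, 0, 0⟩⟩ : TMCell) (pc ps1 0) 32 34 = some l6c3_g0_32_34 := by decide +kernel

end PointKernelK34L515

end Literature.MathematicalPhysics.QuantumFieldTheory.ConformalBootstrap3D
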